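import Summits.BirchSwinnertonDyer.BirchSwinnertonDyer.Theorems.PrintCFramBottomClassIndexLawFiveLeParitySplitPrimitivityFieldFactor
import Summits.BirchSwinnertonDyer.BirchSwinnertonDyer.Theorems.PrintCFramBottomClassIndexLawFiveLeLevelDictionaryBetaShaAn
import Literature.NumberTheory.LFunctions.GeneralizedBernoulliOneOddNonvanishingAnyField
import HarnessLib

/-!
# Crux `PrintCFram.BottomClassIndexLawFiveLe` (stmt-BirchSwinnertonDyer-20372), line `eisenstein-resource-bdp-line` (registry v19):
# THE `L`-VALUE (ANALYTIC Ш) CURRENCY OF STUB C — a Heegner twist pair with `p ∤ #Ш_an` makes the `K''`-factor a unit, so Stub C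
# `stub_heegnerField_of_unitClassFactor` follows VERBATIM from «every rank-one class member has ONE admissible Heegner twist `W^{(d)}`
# with `L(W^{(d)},1) ≠ 0` and `ord_p #Ш_an = 0` on the twist's rational `p`-isogeny pair»
# (cell `bsd-print-cfram`, width seat `bsd-line-cfram-p1-w5` g4; THEOREMS ONLY, `--supports` 20372; BSD is not proved by any of this)

HONEST FRAMING. THEOREMS ONLY (0 defs / 0 facts / 0 sorry); nothing about BSD is proved; no stub is closed; no summit statement is
proved by this seat; the crux C2 stays OPEN and is NOT claimed false. Companion of `…HeegnerTwistShaSupply` (Ш-currency: `Ш[p] = 0` on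
the twist pair) — here the same reading in the currency an analytic number theorist supplies: `#Ш_an(V) = L(V,1)·#V(ℚ)_tors² /
(Ω_V·∏c_ℓ)` (Miller's analytic order, the tree's `shaAn`) of the RANK-ZERO twist and of its `p`-isogenous partner is a `p`-adic
UNIT. Mechanism: w5 g3's `LevelDictionaryBeta.one_le_padicValRat_shaAn_or_partner_of_classFactor` (an Eisenstein-IRREGULAR class
member with `L(W,1) ≠ 0` has `p ∣ #Ш_an` on `W` or on its partner — Mazur–Wiles Thm. 2 + Burungale–Flach Cor. 2 + modularity) applied
to the twist, whose class factor is the field factor of `(W, K'')` (w3 g7 `OffLocusTwistFactor.classFactor_twist_eq_fieldFactor`); the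
side condition `B_{1,ψ̃⁻¹} ≠ 0` is w4 g9's `bernoulliOnePrim_inv_ne_zero_of_odd`.

* §1 **`not_fieldFactor_le_of_twist_shaAn_unit`** — class member `W` (CM, `CMRamified W p`, `p ≥ 5`), odd datum + `hss`, `K''` imaginary
  quadratic with Kronecker `ε`, a globally minimal `C • W.quadraticTwist d_{K''} = Wd` with `L(W^{(d)},1) ≠ 0`, `ord_p #Ш_an(Wd) = 0` and
  `ord_p #Ш_an(W₁) = 0` for every globally minimal CM-ramified `p`-isogenous partner `W₁` of `Wd` ⊢ UNIT field factor. Conditional on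
  `hBF` (Burungale–Flach Cor. 2, conjunct 4 of `stub_prints`), `hmod` (modularity), `hMW`.
* §2 **`stubC_of_heegnerTwistShaAnSupply`** — registry v19's Stub C VERBATIM ⟸ **C_{Ш-an}** := «every rank-one class member has an
  admissible Heegner `K''` (Heegner for `N_W`, `d` odd `< −4`, `L(W^{(d)},1) ≠ 0`) and a globally minimal twist model `Wd` with
  `shaAn Wd = q`, `padicValRat p q = 0` for every such `q`, and the same for every minimal CM-ramified `p`-isogenous partner»;
  `…_binders` (the supplier may use Stub C's own binders).

So the line's analytic residue has THREE kernel-equivalent supply currencies (modulo print): w8 g4's GL(1) statement (P) on generalized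
Bernoulli numbers; this seat's C_Ш (`Ш[p] = 0` on a twist pair); and C_{Ш-an} (`p ∤ #Ш_an` on a twist pair, i.e. a horizontal
non-vanishing mod `p` of the normalised central values `L(W^{(d)},1)/Ω` along the Heegner twist family — the shape of Ono–Skinner /
Bruinier type theorems, which however impose no splitting condition at the level primes, cell presearch w3 g7 / bsd-idea-7 g12 / w8 g4).
beyond-print theorem: NO. CONDITIONAL on the named facts. References: [MazurWiles1984] Thm. 2; [BurungaleFlach2024] Cor. 2; [Miller2011LMS]
§1; [KrizLi2019] Thm. 1.20, §8; [OnoSkinner1998]; crux workfiles `…-lead-g11.md` ADDENDUM, HOME/HANDOFF §line-cfram-p1-w5 g3 FINAL.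
-/

set_option autoImplicit false
-- `…BirchSwinnertonDyer.BirchSwinnertonDyer.Theorems…` is the problem's mandated namespace (D-0017).
set_option linter.dupNamespace false

noncomputable section

open scoped Classical

namespace Summit.BirchSwinnertonDyer.BirchSwinnertonDyer.Theorems.PrintCFram.HeegnerTwistSha

open WeierstrassCurve NumberField IsDedekindDomain DirichletCharacter
  Literature.NumberTheory.EllipticCurves
  Literature.NumberTheory.EllipticCurves.Rank1Residual
  Literature.NumberTheory.EllipticCurves.KrizLi2019
  Literature.NumberTheory.NumberFields
  Summit.BirchSwinnertonDyer.BirchSwinnertonDyer.Theorems.PrintCFram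
open Literature.NumberTheory.LFunctions (bernoulliOnePrim_inv_ne_zero_of_odd)

/-! ## §1 A twist pair with `p ∤ #Ш_an` makes the field factor a unit -/

/-- **UNIT FIELD FACTOR FROM A TWIST PAIR WITH `p ∤ #Ш_an`.** Let `W/ℚ` be elliptic with CM, `p ≥ 5` CM-ramified, `(f, ψ, ω)` an odd datum
with `hss` for `W`, `K` imaginary quadratic with Kronecker `ε_K`, and `Wd` a globally minimal model of `W^{(d_K)}` (`C • W.quadraticTwist d_K = Wd`)
with `L(W^{(d_K)},1) ≠ 0`. If `ord_p #Ш_an(Wd) = 0` (for every rational `q` with `shaAn Wd = q`, `padicValRat p q = 0`) and the same holds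
for every globally minimal, CM, CM-ramified `W₁` with a `p`-isogeny `Wd → W₁`, then the field factor of `(W, K)` is a unit:
`¬ ‖B_{1,(ψε_Kω⁻¹)~}‖_p ≤ p⁻¹`. Proof: `Wd` is a class member with its own odd datum `ψ'` whose class factor equals the field factor
(`OffLocusTwistFactor.classFactor_twist_eq_fieldFactor`); `L(Wd,1) ≠ 0` (`entireLFunction_smul`); a non-unit class factor would give
`1 ≤ ord_p #Ш_an` on `Wd` or on a partner (`LevelDictionaryBeta.one_le_padicValRat_shaAn_or_partner_of_classFactor`, with `B_{1,ψ'⁻¹} ≠ 0`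
from `bernoulliOnePrim_inv_ne_zero_of_odd`). CONDITIONAL on `hBF`, `hmod`, `hMW`; closes no stub.
[cite: MazurWiles1984, Thm. 2 (p. 216)] [cite: BurungaleFlach2024, Cor. 2] [cite: Miller2011LMS, Def. 1.1 (§1)]
[cite: KrizLi2019, Thm. 1.20 (p. 8) and §7.1 (p. 43)] -/
theorem not_fieldFactor_le_of_twist_shaAn_unit {p : ℕ} [Fact p.Prime]
    (hBF : bsdTriple_of_hasCM_of_L_one_ne_zero) (hmod : hasEntireLFunction_rat)
    (hMW : MazurWiles1984.thm2_card_oddChiClassGroup_eq_bernoulli)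
    (W : WeierstrassCurve ℚ) [W.IsElliptic] (hCM : W.HasCM) (hram : CMRamified W p) (h5 : 5 ≤ p)
    {f : ℕ} [NeZero f] (ψ : DirichletCharacter ℚ_[p] f) (ω : DirichletCharacter ℚ_[p] p)
    (hψ : ψ.Odd) (hω : IsTeichmullerCharacter ω)
    (hss : ∀ ℓ : ℕ, ℓ.Prime → ¬ (ℓ ∣ p * W.conductorNorm ℤ) →
      ‖((W.LFunction ℓ : ℤ) : ℚ_[p]) - (ψ (ℓ : ZMod f) + ψ⁻¹ (ℓ : ZMod f) * ω (ℓ : ZMod p))‖ < 1)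
    (K : Type) [Field K] [NumberField K] (hK : IsImaginaryQuadratic K)
    (εK : DirichletCharacter ℚ_[p] (NumberField.discr K).natAbs) (hεK : IsKroneckerCharacterOf K εK)
    (Wd : WeierstrassCurve ℚ) [Wd.IsElliptic] [Wd.IsGloballyMinimal]
    (hC : ∃ C : VariableChange ℚ, C • W.quadraticTwist (NumberField.discr K : ℚ) = Wd)
    (hLt : (W.quadraticTwist (NumberField.discr K : ℚ)).entireLFunction 1 ≠ 0)
    (han : ∀ q : ℚ, shaAn Wd = (q : ℂ) → padicValRat p q = 0)
    (han₁ : ∀ (W₁ : WeierstrassCurve ℚ) [W₁.IsElliptic] [W₁.IsGloballyMinimal], W₁.HasCM → CMRamified W₁ p →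
      (∃ φ : Isogeny Wd W₁, φ.degree = p) → ∀ q : ℚ, shaAn W₁ = (q : ℂ) → padicValRat p q = 0) :
    ¬ ‖bernoulliOnePrim (bernoulliCharTwo ψ εK ω)‖ ≤ (p : ℝ)⁻¹ := by
  intro hfld
  have hD0 : (NumberField.discr K : ℚ) ≠ 0 := by exact_mod_cast NumberField.discr_ne_zero K
  obtain ⟨hCMd, hramd⟩ := ParitySplit.hasCM_and_cmRamified_of_smul_quadraticTwist W hCM hram hD0 Wd hC
  -- the twist's own odd datum
  obtain ⟨f', hf', ψ', ω', -, -, hψ', hω', hss', -, -, -, -⟩ :=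
    OffLocusDictionary.exists_krizLiTriple_odd_of_cmRamified Wd p hCMd hramd h5 K hK.1
  haveI := hf'
  obtain ⟨C, rfl⟩ := hC
  haveI : (W.quadraticTwist (NumberField.discr K : ℚ)).IsElliptic := W.isElliptic_quadraticTwist hD0
  -- the same datum read on the literal twist
  have hssX : ∀ ℓ : ℕ, ℓ.Prime → ¬ (ℓ ∣ p * (W.quadraticTwist (NumberField.discr K : ℚ)).conductorNorm ℤ) →
      ‖(((W.quadraticTwist (NumberField.discr K : ℚ)).LFunction ℓ : ℤ) : ℚ_[p]) -
        (ψ' (ℓ : ZMod f') + ψ'⁻¹ (ℓ : ZMod f') * ω' (ℓ : ZMod p))‖ < 1 := by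
    intro ℓ hℓ hℓN
    have hN : (C • W.quadraticTwist (NumberField.discr K : ℚ)).conductorNorm ℤ =
        (W.quadraticTwist (NumberField.discr K : ℚ)).conductorNorm ℤ :=
      conductorNorm_smul_rat (W.quadraticTwist (NumberField.discr K : ℚ)) C
    have hL : (C • W.quadraticTwist (NumberField.discr K : ℚ)).LFunction =
        (W.quadraticTwist (NumberField.discr K : ℚ)).LFunction :=
      LFunction_smul (W.quadraticTwist (NumberField.discr K : ℚ)) C
    have h := hss' ℓ hℓ (by rw [hN]; exact hℓN)
    rw [hL] at h
    exact h
  -- class factor of the twist = field factor, a NON-unit under `hfld`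
  have hcls' : ‖bernoulliOnePrim ψ'⁻¹‖ ≤ (p : ℝ)⁻¹ := by
    rw [OffLocusTwistFactor.classFactor_twist_eq_fieldFactor W h5 ψ ω hψ hω hss K hK εK hεK ψ' ω' hψ' hω' hssX]
    exact hfld
  have hLd1 : (C • W.quadraticTwist (NumberField.discr K : ℚ)).entireLFunction 1 ≠ 0 := by
    rw [entireLFunction_smul]; exact hLt
  rcases LevelDictionaryBeta.one_le_padicValRat_shaAn_or_partner_of_classFactor (C • W.quadraticTwist (NumberField.discr K : ℚ))
      hBF hmod hMW hCMd hramd h5 hLd1 ψ' ω' hψ' hω' hss' (bernoulliOnePrim_inv_ne_zero_of_odd ψ' hψ') hcls' with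
    ⟨q, hq, h1q⟩ | ⟨W₁, iW₁, iW₁', hCM₁, hram₁, hφ, -, q, hq, h1q⟩
  · have h0 := han q hq
    rw [h0] at h1q
    exact absurd h1q (by norm_num)
  · have h0 := han₁ W₁ hCM₁ hram₁ hφ q hq
    rw [h0] at h1q
    exact absurd h1q (by norm_num)

/-! ## §2 Stub C from the `L`-value (analytic Ш) supply statement -/

/-- **STUB C ⟸ C_{Ш-an}.** Registry v19's Stub C `stub_heegnerField_of_unitClassFactor` — VERBATIM — follows from the `L`-VALUE SUPPLY
STATEMENT **C_{Ш-an}**: «for every globally minimal CM curve `W/ℚ`, `p ≥ 5` CM-ramified, `r_an(W) = 1`, there are an imaginary quadratic `K`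
Heegner for `N_W` with `d_K` odd `< −4` and `L(W^{(d_K)},1) ≠ 0`, and a globally minimal model `Wd` of the twist with `ord_p #Ш_an(Wd) = 0`
and `ord_p #Ш_an(W₁) = 0` for every globally minimal CM-ramified `p`-isogenous partner `W₁` of `Wd`» (`#Ш_an` = the tree's `shaAn`,
Miller's analytic order). The Kronecker character comes from `OffLocusDictionary.exists_isKroneckerCharacterOf`, the unit field factor from §1.
CONDITIONAL on `hBF`, `hmod`, `hMW`; closes no stub; BSD is not proved by any of this. [cite: MazurWiles1984, Thm. 2 (p. 216)]
[cite: BurungaleFlach2024, Cor. 2] [cite: Miller2011LMS, Def. 1.1 (§1)] [cite: KrizLi2019, Thm. 1.20 (p. 8) and §8] -/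
theorem stubC_of_heegnerTwistShaAnSupply
    (hBF : bsdTriple_of_hasCM_of_L_one_ne_zero) (hmod : hasEntireLFunction_rat)
    (hMW : MazurWiles1984.thm2_card_oddChiClassGroup_eq_bernoulli)
    (hSupply : ∀ (W : WeierstrassCurve ℚ) [W.IsElliptic] [W.IsGloballyMinimal] (p : ℕ) [Fact p.Prime],
      W.HasCM → CMRamified W p → 5 ≤ p → W.analyticRank = 1 →
      ∃ (K : Type) (_ : Field K) (_ : NumberField K), IsImaginaryQuadratic K ∧
        SatisfiesHeegnerHypothesis (W.conductorNorm ℤ) K ∧ Odd (NumberField.discr K) ∧ NumberField.discr K < -4 ∧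
        (W.quadraticTwist (NumberField.discr K : ℚ)).entireLFunction 1 ≠ 0 ∧
        ∃ (Wd : WeierstrassCurve ℚ) (_ : Wd.IsElliptic) (_ : Wd.IsGloballyMinimal),
          (∃ C : VariableChange ℚ, C • W.quadraticTwist (NumberField.discr K : ℚ) = Wd) ∧
          (∀ q : ℚ, shaAn Wd = (q : ℂ) → padicValRat p q = 0) ∧
          (∀ (W₁ : WeierstrassCurve ℚ) [W₁.IsElliptic] [W₁.IsGloballyMinimal], W₁.HasCM → CMRamified W₁ p →
            (∃ φ : Isogeny Wd W₁, φ.degree = p) → ∀ q : ℚ, shaAn W₁ = (q : ℂ) → padicValRat p q = 0)) :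
    ∀ (W : WeierstrassCurve ℚ) [W.IsElliptic] [W.IsGloballyMinimal] (p : ℕ) [Fact p.Prime], W.HasCM → CMRamified W p → 5 ≤ p →
      W.analyticRank = 1 → ∀ (f : ℕ) [NeZero f] (ψ : DirichletCharacter ℚ_[p] f) (ω : DirichletCharacter ℚ_[p] p), ψ.Odd →
      IsTeichmullerCharacter ω →
      (∀ ℓ : ℕ, ℓ.Prime → ¬ (ℓ ∣ p * W.conductorNorm ℤ) →
        ‖((W.LFunction ℓ : ℤ) : ℚ_[p]) - (ψ (ℓ : ZMod f) + ψ⁻¹ (ℓ : ZMod f) * ω (ℓ : ZMod p))‖ < 1) →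
      ¬ ‖bernoulliOnePrim ψ⁻¹‖ ≤ (p : ℝ)⁻¹ →
      ∃ (K : Type) (_ : Field K) (_ : NumberField K) (εK : DirichletCharacter ℚ_[p] (NumberField.discr K).natAbs),
        IsImaginaryQuadratic K ∧ SatisfiesHeegnerHypothesis (W.conductorNorm ℤ) K ∧ Odd (NumberField.discr K) ∧
        NumberField.discr K < -4 ∧ IsKroneckerCharacterOf K εK ∧
        ¬ ‖bernoulliOnePrim (bernoulliCharTwo ψ εK ω)‖ ≤ (p : ℝ)⁻¹ := by
  intro W _ _ p _ hCM hram h5 hr f _ ψ ω hψ hω hss _hcls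
  obtain ⟨K, iK, iK', hK, hH, hodd, hd4, hLt, Wd, iWd, iWd', hC, han, han₁⟩ := hSupply W p hCM hram h5 hr
  obtain ⟨εK, hεK⟩ := OffLocusDictionary.exists_isKroneckerCharacterOf (p := p) hK.1
  exact ⟨K, iK, iK', εK, hK, hH, hodd, hd4, hεK,
    not_fieldFactor_le_of_twist_shaAn_unit hBF hmod hMW W hCM hram h5 ψ ω hψ hω hss K hK εK hεK Wd hC hLt han han₁⟩

/-- **STUB C ⟸ C_{Ш-an}♭ (THE SUPPLIER MAY USE STUB C's OWN BINDERS):** as `stubC_of_heegnerTwistShaAnSupply`, the supply statement also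
receiving the class's odd datum with `hss` and the UNIT CLASS FACTOR. CONDITIONAL on `hBF`, `hmod`, `hMW`; closes no stub.
[cite: MazurWiles1984, Thm. 2 (p. 216)] [cite: BurungaleFlach2024, Cor. 2] [cite: KrizLi2019, Thm. 1.20 (p. 8) and §8] -/
theorem stubC_of_heegnerTwistShaAnSupply_binders
    (hBF : bsdTriple_of_hasCM_of_L_one_ne_zero) (hmod : hasEntireLFunction_rat)
    (hMW : MazurWiles1984.thm2_card_oddChiClassGroup_eq_bernoulli)
    (hSupply : ∀ (W : WeierstrassCurve ℚ) [W.IsElliptic] [W.IsGloballyMinimal] (p : ℕ) [Fact p.Prime],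
      W.HasCM → CMRamified W p → 5 ≤ p → W.analyticRank = 1 →
      ∀ (f : ℕ) [NeZero f] (ψ : DirichletCharacter ℚ_[p] f) (ω : DirichletCharacter ℚ_[p] p), ψ.Odd →
      IsTeichmullerCharacter ω →
      (∀ ℓ : ℕ, ℓ.Prime → ¬ (ℓ ∣ p * W.conductorNorm ℤ) →
        ‖((W.LFunction ℓ : ℤ) : ℚ_[p]) - (ψ (ℓ : ZMod f) + ψ⁻¹ (ℓ : ZMod f) * ω (ℓ : ZMod p))‖ < 1) →
      ¬ ‖bernoulliOnePrim ψ⁻¹‖ ≤ (p : ℝ)⁻¹ →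
      ∃ (K : Type) (_ : Field K) (_ : NumberField K), IsImaginaryQuadratic K ∧
        SatisfiesHeegnerHypothesis (W.conductorNorm ℤ) K ∧ Odd (NumberField.discr K) ∧ NumberField.discr K < -4 ∧
        (W.quadraticTwist (NumberField.discr K : ℚ)).entireLFunction 1 ≠ 0 ∧
        ∃ (Wd : WeierstrassCurve ℚ) (_ : Wd.IsElliptic) (_ : Wd.IsGloballyMinimal),
          (∃ C : VariableChange ℚ, C • W.quadraticTwist (NumberField.discr K : ℚ) = Wd) ∧
          (∀ q : ℚ, shaAn Wd = (q : ℂ) → padicValRat p q = 0) ∧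
          (∀ (W₁ : WeierstrassCurve ℚ) [W₁.IsElliptic] [W₁.IsGloballyMinimal], W₁.HasCM → CMRamified W₁ p →
            (∃ φ : Isogeny Wd W₁, φ.degree = p) → ∀ q : ℚ, shaAn W₁ = (q : ℂ) → padicValRat p q = 0)) :
    ∀ (W : WeierstrassCurve ℚ) [W.IsElliptic] [W.IsGloballyMinimal] (p : ℕ) [Fact p.Prime], W.HasCM → CMRamified W p → 5 ≤ p →
      W.analyticRank = 1 → ∀ (f : ℕ) [NeZero f] (ψ : DirichletCharacter ℚ_[p] f) (ω : DirichletCharacter ℚ_[p] p), ψ.Odd →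
      IsTeichmullerCharacter ω →
      (∀ ℓ : ℕ, ℓ.Prime → ¬ (ℓ ∣ p * W.conductorNorm ℤ) →
        ‖((W.LFunction ℓ : ℤ) : ℚ_[p]) - (ψ (ℓ : ZMod f) + ψ⁻¹ (ℓ : ZMod f) * ω (ℓ : ZMod p))‖ < 1) →
      ¬ ‖bernoulliOnePrim ψ⁻¹‖ ≤ (p : ℝ)⁻¹ →
      ∃ (K : Type) (_ : Field K) (_ : NumberField K) (εK : DirichletCharacter ℚ_[p] (NumberField.discr K).natAbs),
        IsImaginaryQuadratic K ∧ SatisfiesHeegnerHypothesis (W.conductorNorm ℤ) K ∧ Odd (NumberField.discr K) ∧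
        NumberField.discr K < -4 ∧ IsKroneckerCharacterOf K εK ∧
        ¬ ‖bernoulliOnePrim (bernoulliCharTwo ψ εK ω)‖ ≤ (p : ℝ)⁻¹ := by
  intro W _ _ p _ hCM hram h5 hr f _ ψ ω hψ hω hss hcls
  obtain ⟨K, iK, iK', hK, hH, hodd, hd4, hLt, Wd, iWd, iWd', hC, han, han₁⟩ :=
    hSupply W p hCM hram h5 hr f ψ ω hψ hω hss hcls
  obtain ⟨εK, hεK⟩ := OffLocusDictionary.exists_isKroneckerCharacterOf (p := p) hK.1
  exact ⟨K, iK, iK', εK, hK, hH, hodd, hd4, hεK,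
    not_fieldFactor_le_of_twist_shaAn_unit hBF hmod hMW W hCM hram h5 ψ ω hψ hω hss K hK εK hεK Wd hC hLt han han₁⟩

end Summit.BirchSwinnertonDyer.BirchSwinnertonDyer.Theorems.PrintCFram.HeegnerTwistSha

end
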